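import Literature.NumberTheory.Sieve.SmoothNumbersUpperBoundLHalfExplicit
import HarnessLib

/-!
# Smooth numbers in the `L[1/2]` range, upper bound: `ψ(x, L_x[1/2, β]) ≤ x · L_x[1/2, −1/(2β) + o(1)]`

Sequel of `SmoothNumbersUpperBoundLHalfExplicit.lean` (Rankin's method in explicit form,
`LHalfUpper.card_smoothNumbersUpTo_le_rpow_mul_exp`). Here the parameters are chosen —
`y₀ = ⌈exp(β L)⌉`, `L = √(log x log log x)`, `u = log x/log y₀`, `σ = 1 − log u/log y₀` — and the
bookkeeping in `s = log log x` (`LHalfUpper.exists_threshold`) gives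

* `card_smoothNumbersUpTo_le_LHalf` — for `β, ε > 0`, eventually in `x`, for all
  `y ≤ exp(β √(log x log log x))`:
  `Ψ(x, y+1) = #{1 ≤ n ≤ x : p ∣ n ⇒ p ≤ y} ≤ x · exp(−(1/(2β) − ε) √(log x · log log x))`.

With `card_smoothNumbersUpTo_ge_LHalf` (`SmoothNumbersLowerBoundLHalf.lean`):
`ψ(x, L_x[1/2, β]) = x · L_x[1/2, −1/(2β) + o(1)]` (Canfield–Erdős–Pomerance 1983; de Bruijn 1966),
the two-sided estimate behind every `L[1/2]` analysis (Lenstra–Pomerance 1992, §10, proof of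
Theorem 10.3). Everything is proved; no named facts.

## References

* N. G. de Bruijn, Indag. Math. 28 (1966) 239–247. E. R. Canfield, P. Erdős, C. Pomerance,
  J. Number Theory 17 (1983) 1–28.
* H. W. Lenstra Jr., C. Pomerance, J. Amer. Math. Soc. 5 (1992) 483–516, §10. [LenstraPomerance1992]
-/

noncomputable section

namespace Literature.NumberTheory.Sieve

open Finset Real Filter

namespace LHalfUpper

/-! ### Bookkeeping in `s = log log x` (with `L = e^{s/2} √s`, `u₀ = L/(β s)`, `log u₀ = s/2 − (log s)/2 − log β`) -/

/-- The main term: for `u' ≥ u₀ − 1`, `u' log u' ≥ (1/(2β) − ε/2) L` once `u₀ ≥ 2` and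
`s ≥ (2/(βε)) (|log (2/(βε))| + 2 |log β| + 3)`. [folklore] -/
theorem main_term {β ε s L u₀ u' : ℝ} (hβ : 0 < β) (hε : 0 < ε) (hs1 : 1 ≤ s)
    (hL : L = Real.exp (s / 2) * Real.sqrt s) (hu₀ : u₀ = L / (β * s)) (hu₀2 : 2 ≤ u₀)
    (hlow : u₀ - 1 ≤ u')
    (hsT : 2 / (β * ε) * (|Real.log (2 / (β * ε))| + 2 * |Real.log β| + 3) ≤ s) :
    (1 / (2 * β) - ε / 2) * L ≤ u' * Real.log u' := by
  have hs0 : 0 < s := by linarith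
  have hL0 : 0 < L := by rw [hL]; positivity
  set lu : ℝ := s / 2 - Real.log s / 2 - Real.log β with hlu
  have hlogu₀ : Real.log u₀ = lu := by rw [hu₀, hL]; exact LHalf.log_u_eq hβ hs0
  -- `u' log u' ≥ (u₀ - 1) log (u₀ - 1) ≥ (u₀ - 1) (log u₀ - 1)`
  have h1 : (u₀ - 1) * Real.log (u₀ - 1) ≤ u' * Real.log u' :=
    LHalf.mul_log_le_mul_log (by linarith) hlow (by linarith)
  have h2 : Real.log u₀ - 1 ≤ Real.log (u₀ - 1) := by
    have he : Real.log u₀ - 1 = Real.log (u₀ / Real.exp 1) := by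
      rw [Real.log_div (by linarith) (Real.exp_pos 1).ne', Real.log_exp]
    rw [he]
    apply Real.log_le_log (by positivity)
    rw [div_le_iff₀ (Real.exp_pos 1)]
    have := Real.exp_one_gt_d9
    nlinarith
  have h3 : (u₀ - 1) * (Real.log u₀ - 1) ≤ (u₀ - 1) * Real.log (u₀ - 1) :=
    mul_le_mul_of_nonneg_left h2 (by linarith)
  -- `lu ≤ u₀`
  have hlu_le : lu ≤ u₀ := by
    rw [← hlogu₀]
    have := Real.log_le_sub_one_of_pos (show 0 < u₀ by linarith)
    linarith
  -- the exact value of `u₀ lu`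
  have hprod : u₀ * lu = L / (2 * β) - L * (Real.log s + 2 * Real.log β) / (2 * β * s) := by
    rw [hu₀, hlu]; field_simp; ring
  -- `log s ≤ (βε/2) s - 1 + log (2/(βε))`
  have ha : 0 < 2 / (β * ε) := by positivity
  have hlogs : Real.log s ≤ s / (2 / (β * ε)) - 1 + Real.log (2 / (β * ε)) :=
    LHalf.log_le_div_sub_one_add_log hs0 ha
  have hlogs' : Real.log s ≤ β * ε / 2 * s - 1 + |Real.log (2 / (β * ε))| := by
    have e : s / (2 / (β * ε)) = β * ε / 2 * s := by field_simp
    rw [e] at hlogs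
    linarith [le_abs_self (Real.log (2 / (β * ε)))]
  have hB := le_abs_self (Real.log β)
  have hlogs0 : 0 ≤ Real.log s := Real.log_nonneg hs1
  -- the error `L (log s + 2 log β)/(2βs) + 2 L/(βs) ≤ (ε/2) L`
  have hkey : L * (Real.log s + 2 * Real.log β) / (2 * β * s) + 2 * u₀ ≤ ε / 2 * L := by
    rw [hu₀]
    have hsT' : |Real.log (2 / (β * ε))| + 2 * |Real.log β| + 3 ≤ β * ε / 2 * s := by
      have := hsT
      rw [div_mul_eq_mul_div, div_le_iff₀ (by positivity)] at this
      nlinarith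
    have hnum : Real.log s + 2 * Real.log β + 4 ≤ β * ε * s := by linarith
    have e1 : L * (Real.log s + 2 * Real.log β) / (2 * β * s) + 2 * (L / (β * s)) =
        L / (2 * β * s) * (Real.log s + 2 * Real.log β + 4) := by field_simp; ring
    rw [e1]
    calc L / (2 * β * s) * (Real.log s + 2 * Real.log β + 4)
        ≤ L / (2 * β * s) * (β * ε * s) := mul_le_mul_of_nonneg_left hnum (by positivity)
      _ = ε / 2 * L := by field_simp
  -- assemble
  have h4 : (u₀ - 1) * (Real.log u₀ - 1) = u₀ * lu - u₀ - lu + 1 := by rw [hlogu₀]; ring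
  have h5 : (1 / (2 * β) - ε / 2) * L ≤ u₀ * lu - u₀ - lu + 1 := by
    have e : (1 / (2 * β) - ε / 2) * L = L / (2 * β) - ε / 2 * L := by ring
    have e2 : u₀ * lu = L / (2 * β) - (L * (Real.log s + 2 * Real.log β) / (2 * β * s)) := hprod
    rw [e, e2]
    linarith
  linarith

/-- The error terms: `4 √u₀ (s + c₂) + 4 u₀ c₁ ≤ (ε/2) L` once
`s ≥ 16 c₁/(βε) + c₂ + 262144/(βε²)` (`c₁, c₂ ≥ 0`). [folklore] -/
theorem error_terms {β ε s L u₀ c₁ c₂ : ℝ} (hβ : 0 < β) (hε : 0 < ε) (hs1 : 1 ≤ s)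
    (hL : L = Real.exp (s / 2) * Real.sqrt s) (hu₀ : u₀ = L / (β * s)) (hc₁ : 0 ≤ c₁) (hc₂ : 0 ≤ c₂)
    (hsE : 16 * c₁ / (β * ε) + c₂ + 262144 / (β * ε ^ 2) ≤ s) :
    4 * Real.sqrt u₀ * (s + c₂) + 4 * u₀ * c₁ ≤ ε / 2 * L := by
  have hs0 : 0 < s := by linarith
  have hL0 : 0 < L := by rw [hL]; positivity
  have hu₀0 : 0 < u₀ := by rw [hu₀]; positivity
  have t1 : 0 ≤ 16 * c₁ / (β * ε) := by positivity
  have t3 : 0 ≤ 262144 / (β * ε ^ 2) := by positivity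
  -- `4 u₀ c₁ ≤ (ε/4) L`
  have hA : 4 * u₀ * c₁ ≤ ε / 4 * L := by
    rw [hu₀]
    have h1 : 16 * c₁ / (β * ε) ≤ s := by linarith
    rw [div_le_iff₀ (by positivity)] at h1
    have e : 4 * (L / (β * s)) * c₁ = (4 * c₁ / (β * s)) * L := by field_simp
    rw [e]
    refine mul_le_mul_of_nonneg_right ?_ hL0.le
    rw [div_le_iff₀ (by positivity)]
    nlinarith
  -- `4 √u₀ (s + c₂) ≤ (ε/4) L`, via `√u₀ ≤ t = ε L/(16 (s + c₂))`
  have hsc : 0 < s + c₂ := by linarith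
  set t : ℝ := ε * L / (16 * (s + c₂)) with ht
  have ht0 : 0 ≤ t := by positivity
  have hexp : s ^ 2 / 16 ≤ Real.exp (s / 2) := LHalf.sq_div_le_exp_half hs0.le
  have hLlow : s ^ 2 * Real.sqrt s / 16 ≤ L := by
    rw [hL]
    have := Real.sqrt_nonneg s
    nlinarith
  have hsq1 : 1 ≤ Real.sqrt s := by rw [Real.one_le_sqrt]; exact hs1
  have hu₀t : u₀ ≤ t ^ 2 := by
    -- `L/(βs) ≤ ε² L² /(256 (s+c₂)²)` iff `256 (s + c₂)² ≤ β ε² s L`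
    rw [hu₀, ht, div_pow, div_le_div_iff₀ (by positivity) (by positivity)]
    have h2 : (s + c₂) ^ 2 ≤ 4 * s ^ 2 := by nlinarith
    have h3 : 262144 / (β * ε ^ 2) ≤ s := by linarith
    rw [div_le_iff₀ (by positivity)] at h3
    -- `16384 s ≤ β ε² L`
    have h4 : 16384 * s ≤ β * ε ^ 2 * L := by
      have h5 : β * ε ^ 2 * (s ^ 2 * Real.sqrt s / 16) ≤ β * ε ^ 2 * L :=
        mul_le_mul_of_nonneg_left hLlow (by positivity)
      have h6 : β * ε ^ 2 * s ^ 2 / 16 ≤ β * ε ^ 2 * (s ^ 2 * Real.sqrt s / 16) := by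
        have : β * ε ^ 2 * s ^ 2 ≤ β * ε ^ 2 * s ^ 2 * Real.sqrt s := by
          have h0 : 0 ≤ β * ε ^ 2 * s ^ 2 := by positivity
          nlinarith
        linarith
      nlinarith
    have hL2 : L * (16 * (s + c₂)) ^ 2 = 256 * (s + c₂) ^ 2 * L := by ring
    rw [hL2]
    have h7 : 256 * (s + c₂) ^ 2 * L ≤ 1024 * s ^ 2 * L := by nlinarith
    have h8 : (ε * L) ^ 2 * (β * s) = (β * ε ^ 2 * L) * (s * L) := by ring
    have h9 : 16384 * s * (s * L) ≤ (β * ε ^ 2 * L) * (s * L) :=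
      mul_le_mul_of_nonneg_right h4 (by positivity)
    have h10 : 1024 * s ^ 2 * L ≤ 16384 * s * (s * L) := by nlinarith
    rw [h8]
    linarith
  have hsqrt : Real.sqrt u₀ ≤ t := by
    rw [← Real.sqrt_sq ht0]
    exact Real.sqrt_le_sqrt hu₀t
  have hB : 4 * Real.sqrt u₀ * (s + c₂) ≤ ε / 4 * L := by
    calc 4 * Real.sqrt u₀ * (s + c₂) ≤ 4 * t * (s + c₂) := by
          have := Real.sqrt_nonneg u₀; nlinarith
      _ = ε / 4 * L := by rw [ht]; field_simp; ring
  linarith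

/-- The parameter conditions: `2 ≤ u₀`, `u₀ ≤ β L`, `log u₀ ≤ β L/2` and `2 ≤ β L` once
`s ≥ 4 (2 + |log β|) + 1/β² + 2 |log β| + 32/β`. [folklore] -/
theorem params {β s L u₀ : ℝ} (hβ : 0 < β) (hs1 : 1 ≤ s)
    (hL : L = Real.exp (s / 2) * Real.sqrt s) (hu₀ : u₀ = L / (β * s))
    (hsP : 4 * (2 + |Real.log β|) + 1 / β ^ 2 + 2 * |Real.log β| + 32 / β ≤ s) :
    2 ≤ u₀ ∧ u₀ ≤ β * L ∧ Real.log u₀ ≤ β * L / 2 ∧ 2 ≤ β * L := by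
  have hs0 : 0 < s := by linarith
  have hL0 : 0 < L := by rw [hL]; positivity
  have hu₀0 : 0 < u₀ := by rw [hu₀]; positivity
  have hB0 : 0 ≤ |Real.log β| := abs_nonneg _
  have t1 : 0 ≤ 1 / β ^ 2 := by positivity
  have t2 : 0 ≤ 32 / β := by positivity
  set lu : ℝ := s / 2 - Real.log s / 2 - Real.log β with hlu
  have hlogu₀ : Real.log u₀ = lu := by rw [hu₀, hL]; exact LHalf.log_u_eq hβ hs0
  obtain ⟨hlu_lo, hlu_hi⟩ := LHalf.lu_bounds hs1 hlu
  -- `2 ≤ u₀` from `log u₀ ≥ s/4 - |log β| ≥ 1`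
  have h1 : 2 ≤ u₀ := by
    have hlu1 : 1 ≤ lu := by linarith
    have : Real.exp 1 ≤ u₀ := by
      rw [← Real.exp_log hu₀0, Real.exp_le_exp, hlogu₀]; exact hlu1
    linarith [Real.add_one_le_exp (1 : ℝ)]
  -- `β L ≥ β s² √s /16 ≥ …`
  have hLlow := LHalf.betaL_lower hβ hs0
  rw [← hL] at hLlow
  have hsq1 : 1 ≤ Real.sqrt s := by rw [Real.one_le_sqrt]; exact hs1
  have h32 : 32 ≤ β * s := by
    have : 32 / β ≤ s := by linarith
    rwa [div_le_iff₀' hβ] at this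
  have hβL : 2 * s ≤ β * L := by
    -- `β s² √s /16 ≥ β s · s /16 ≥ 2 s`
    have : β * s ^ 2 * Real.sqrt s / 16 ≥ β * s * s / 16 := by
      have h0 : 0 ≤ β * s * s := by positivity
      nlinarith
    nlinarith
  refine ⟨h1, ?_, ?_, by linarith⟩
  · -- `u₀ ≤ β L` iff `1 ≤ β² s`
    rw [hu₀, div_le_iff₀ (by positivity)]
    have h1β : 1 / β ^ 2 ≤ s := by linarith
    rw [div_le_iff₀ (by positivity)] at h1β
    nlinarith
  · -- `log u₀ = lu ≤ s ≤ β L / 2`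
    rw [hlogu₀]
    have : lu ≤ s := by linarith
    linarith

/-- The threshold collecting `main_term`, `error_terms` and `params`. [folklore] -/
theorem exists_threshold {β ε : ℝ} (hβ : 0 < β) (hε : 0 < ε) (c₁ c₂ : ℝ) (hc₁ : 0 ≤ c₁)
    (hc₂ : 0 ≤ c₂) :
    ∃ s₀ : ℝ, 1 ≤ s₀ ∧ ∀ s : ℝ, s₀ ≤ s → ∀ L u₀ : ℝ,
      L = Real.exp (s / 2) * Real.sqrt s → u₀ = L / (β * s) →
      (2 ≤ u₀ ∧ u₀ ≤ β * L ∧ Real.log u₀ ≤ β * L / 2 ∧ 2 ≤ β * L) ∧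
      (∀ u' : ℝ, u₀ - 1 ≤ u' → (1 / (2 * β) - ε / 2) * L ≤ u' * Real.log u') ∧
      4 * Real.sqrt u₀ * (s + c₂) + 4 * u₀ * c₁ ≤ ε / 2 * L := by
  set TP : ℝ := 4 * (2 + |Real.log β|) + 1 / β ^ 2 + 2 * |Real.log β| + 32 / β
  set TM : ℝ := 2 / (β * ε) * (|Real.log (2 / (β * ε))| + 2 * |Real.log β| + 3)
  set TE : ℝ := 16 * c₁ / (β * ε) + c₂ + 262144 / (β * ε ^ 2)
  have hTP : 0 ≤ TP := by positivity
  have hTM : 0 ≤ TM := by positivity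
  have hTE : 0 ≤ TE := by positivity
  refine ⟨1 + TP + TM + TE, by linarith, fun s hs L u₀ hL hu₀ => ?_⟩
  have hs1 : 1 ≤ s := by linarith
  have hP := params hβ hs1 hL hu₀ (by linarith)
  refine ⟨hP, fun u' h1 => main_term hβ hε hs1 hL hu₀ hP.1 h1 (by linarith),
    error_terms hβ hε hs1 hL hu₀ hc₁ hc₂ (by linarith)⟩

/-- Facts about `Y = ⌈e^T⌉` (`T ≥ 2`): `e^T ≤ Y ≤ e^{T+1}`, `T ≤ log Y ≤ T + 1`, `Y ≥ 4`. [folklore] -/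
theorem ceil_exp_facts {T : ℝ} (hT : 2 ≤ T) :
    Real.exp T ≤ (⌈Real.exp T⌉₊ : ℕ) ∧ T ≤ Real.log (⌈Real.exp T⌉₊ : ℕ) ∧
      Real.log (⌈Real.exp T⌉₊ : ℕ) ≤ T + 1 ∧ 4 ≤ ⌈Real.exp T⌉₊ := by
  set Y : ℕ := ⌈Real.exp T⌉₊ with hY
  have hYge : Real.exp T ≤ Y := Nat.le_ceil _
  have he := Real.exp_one_gt_d9
  have hYle : (Y : ℝ) ≤ Real.exp (T + 1) := by
    have h1 : (Y : ℝ) < Real.exp T + 1 := Nat.ceil_lt_add_one (Real.exp_pos _).le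
    have h2 : Real.exp T + 1 ≤ Real.exp (T + 1) := by
      rw [Real.exp_add]
      have h0 : 1 ≤ Real.exp T := Real.one_le_exp (by linarith)
      nlinarith
    linarith
  have hY0 : (0 : ℝ) < Y := lt_of_lt_of_le (Real.exp_pos _) hYge
  refine ⟨hYge, ?_, ?_, ?_⟩
  · have := Real.log_le_log (Real.exp_pos _) hYge
    rwa [Real.log_exp] at this
  · have := Real.log_le_log hY0 hYle
    rwa [Real.log_exp] at this
  · have h4 : (4 : ℝ) ≤ Real.exp T := by
      have h2 : Real.exp 2 ≤ Real.exp T := Real.exp_le_exp.2 hT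
      have : (4 : ℝ) ≤ Real.exp 2 := by
        rw [show (2 : ℝ) = 1 + 1 by norm_num, Real.exp_add]; nlinarith
      linarith
    exact_mod_cast h4.trans hYge

/-- `u = log x / log Y` lies in `[u₀ − 1, u₀]` when `β L ≤ log Y ≤ β L + 1`, `u₀ β L = log x`,
`u₀ ≤ β L`. [folklore] -/
theorem u_bounds {lx logY T u₀ : ℝ} (hT : 0 < T) (hlo : T ≤ logY) (hhi : logY ≤ T + 1)
    (hu₀ : u₀ * T = lx) (hu₀T : u₀ ≤ T) (hlx : 0 < lx) :
    lx / logY ≤ u₀ ∧ u₀ - 1 ≤ lx / logY := by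
  have hlogY : 0 < logY := lt_of_lt_of_le hT hlo
  have hu₀0 : 0 < u₀ := by
    by_contra h
    rw [not_lt] at h
    nlinarith
  constructor
  · rw [div_le_iff₀ hlogY, ← hu₀]
    nlinarith
  · have h1 : lx / (T + 1) ≤ lx / logY := div_le_div_of_nonneg_left hlx.le hlogY hhi
    have h2 : u₀ - 1 ≤ lx / (T + 1) := by
      rw [le_div_iff₀ (by linarith), ← hu₀]
      nlinarith
    linarith

/-- The error terms at the actual `u ≤ u₀` and `log Y ≤ 2 β L`. [folklore] -/
theorem error_at_u {β s L u u₀ K ε logY : ℝ} (hβ : 0 < β) (hs0 : 0 < s) (hL0 : 0 < L)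
    (hL : L = Real.exp (s / 2) * Real.sqrt s) (hu0 : 0 < u) (hu : u ≤ u₀) (hlogY1 : 1 ≤ logY)
    (hlogY : logY ≤ 2 * β * L)
    (herr : 4 * Real.sqrt u₀ * (s + (|Real.log (2 * β)| + 4)) + 4 * u₀ * (Real.log 2 + 3 * |K|) ≤
      ε / 2 * L) :
    4 * (Real.sqrt u * (Real.log logY + 4) + u * (Real.log 2 + 3 * K / logY)) ≤ ε / 2 * L := by
  have hlogY0 : 0 < logY := by linarith
  have hu₀0 : 0 < u₀ := lt_of_lt_of_le hu0 hu
  have hllY : Real.log logY ≤ s + |Real.log (2 * β)| := by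
    have h2 : Real.log logY ≤ Real.log (2 * β * L) := Real.log_le_log hlogY0 hlogY
    have h3 : Real.log (2 * β * L) = Real.log (2 * β) + Real.log L :=
      Real.log_mul (by positivity) hL0.ne'
    have h4 : Real.log L ≤ s := by
      rw [hL, Real.log_mul (by positivity) (Real.sqrt_pos.2 hs0).ne', Real.log_exp,
        Real.log_sqrt hs0.le]
      have : Real.log s ≤ s := (Real.log_le_sub_one_of_pos hs0).trans (by linarith)
      linarith
    linarith [le_abs_self (Real.log (2 * β))]
  have hsqu : Real.sqrt u ≤ Real.sqrt u₀ := Real.sqrt_le_sqrt hu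
  have hKY : 3 * K / logY ≤ 3 * |K| := by
    calc 3 * K / logY ≤ 3 * |K| / logY := by gcongr; exact le_abs_self K
      _ ≤ 3 * |K| := div_le_self (by positivity) hlogY1
  have e1 : Real.sqrt u * (Real.log logY + 4) ≤ Real.sqrt u₀ * (s + (|Real.log (2 * β)| + 4)) := by
    have h0 : 0 ≤ Real.log logY + 4 := by
      have : 0 ≤ Real.log logY := Real.log_nonneg hlogY1
      linarith
    exact mul_le_mul hsqu (by linarith) h0 (Real.sqrt_nonneg _)
  have e2 : u * (Real.log 2 + 3 * K / logY) ≤ u₀ * (Real.log 2 + 3 * |K|) := by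
    have hl2 := Real.log_two_gt_d9
    by_cases hsgn : 0 ≤ Real.log 2 + 3 * K / logY
    · exact mul_le_mul hu (by linarith) hsgn hu₀0.le
    · rw [not_le] at hsgn
      have h1 : u * (Real.log 2 + 3 * K / logY) ≤ 0 := mul_nonpos_of_nonneg_of_nonpos hu0.le hsgn.le
      have h2 : 0 ≤ u₀ * (Real.log 2 + 3 * |K|) := by positivity
      linarith
  linarith

/-- `x^{1 − log u/log Y} = x · e^{−u log u}` for `u = log x/log Y`. [folklore] -/
theorem rpow_sigma_eq {X logY u : ℝ} (hX : 0 < X) (hlogY : logY ≠ 0) (hu : u = Real.log X / logY) :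
    X ^ (1 - Real.log u / logY) = X * Real.exp (-(u * Real.log u)) := by
  rw [Real.rpow_def_of_pos hX]
  conv_rhs => rw [← Real.exp_log hX, ← Real.exp_add]
  congr 1
  have : Real.log u / logY * Real.log X = u * Real.log u := by rw [hu]; field_simp
  linear_combination (-1 : ℝ) * this

end LHalfUpper

/-! ### The `L[1/2]` upper bound -/

/-- **Smooth numbers in the `L[1/2]` range, upper bound.** For every `β > 0` and `ε > 0`, for all
sufficiently large `x` and every `y ≤ L_x[1/2, β] = exp (β √(log x · log log x))`, the number
`Ψ(x, y+1) = #{1 ≤ n ≤ x : p ∣ n ⇒ p ≤ y}` (Mathlib's `Nat.smoothNumbersUpTo x (y+1)`) satisfies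
`Ψ(x, y+1) ≤ x · exp (−(1/(2β) − ε) √(log x · log log x)) = x · L_x[1/2, −1/(2β) + ε]`.
With the lower bound `card_smoothNumbersUpTo_ge_LHalf`: `ψ(x, L_x[1/2, β]) = x L_x[1/2, −1/(2β) + o(1)]`.
(Rankin's method `card_smoothNumbersUpTo_le_rpow_mul_exp` at `y₀ = ⌈L_x[1/2, β]⌉`,
`u = log x/log y₀`, the bookkeeping `LHalfUpper.exists_threshold`, and monotonicity in `y`.)
[cite: LenstraPomerance1992, §10 proof of Thm 10.3] -/
theorem card_smoothNumbersUpTo_le_LHalf {β ε : ℝ} (hβ : 0 < β) (hε : 0 < ε) :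
    ∀ᶠ x : ℕ in atTop, ∀ y : ℕ,
      (y : ℝ) ≤ Real.exp (β * Real.sqrt (Real.log x * Real.log (Real.log x))) →
        ((Nat.smoothNumbersUpTo x (y + 1)).card : ℝ) ≤
          (x : ℝ) * Real.exp (-(1 / (2 * β) - ε) * Real.sqrt (Real.log x * Real.log (Real.log x))) := by
  obtain ⟨K, hK⟩ := Literature.NumberTheory.LFunctions.Mertens.abs_sum_primesLE_inv_sub_loglog_le 1
  set c₁ : ℝ := Real.log 2 + 3 * |K| with hc₁
  set c₂ : ℝ := |Real.log (2 * β)| + 4 with hc₂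
  have hc₁0 : 0 ≤ c₁ := by have := Real.log_two_gt_d9; positivity
  have hc₂0 : 0 ≤ c₂ := by positivity
  obtain ⟨s₀, hs₀1, H⟩ := LHalfUpper.exists_threshold hβ hε c₁ c₂ hc₁0 hc₂0
  have hll : Tendsto (fun x : ℕ => Real.log (Real.log (x : ℝ))) atTop atTop :=
    Real.tendsto_log_atTop.comp (Real.tendsto_log_atTop.comp tendsto_natCast_atTop_atTop)
  filter_upwards [hll.eventually_ge_atTop s₀] with x hxs y hy
  -- `s`, `lx`, `L`
  set lx : ℝ := Real.log (x : ℝ) with hlx_def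
  set s : ℝ := Real.log lx with hs_def
  set L : ℝ := Real.sqrt (lx * s) with hL_def
  have hs1 : 1 ≤ s := hs₀1.trans hxs
  have hs0 : 0 < s := by linarith
  have hlx_pos : 0 < lx := by
    rcases (Real.log_natCast_nonneg x).lt_or_eq with h | h
    · exact h
    · have h' : lx = 0 := by rw [hlx_def]; exact h.symm
      have : s = 0 := by rw [hs_def, h', Real.log_zero]
      linarith
  have hlx_exp : lx = Real.exp s := by rw [hs_def, Real.exp_log hlx_pos]
  have hX1 : (1 : ℝ) < x := (Real.log_pos_iff (Nat.cast_nonneg x)).1 hlx_pos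
  have hL_eq : L = Real.exp (s / 2) * Real.sqrt s := by
    rw [hL_def, hlx_exp, Real.sqrt_mul (Real.exp_pos _).le, Real.exp_half]
  have hL0 : 0 < L := by rw [hL_eq]; positivity
  have hLsq : L * L = lx * s := by rw [hL_def]; exact Real.mul_self_sqrt (by positivity)
  set u₀ : ℝ := L / (β * s) with hu₀_def
  have hu₀lx : u₀ * (β * L) = lx := by rw [hu₀_def]; field_simp; linear_combination hLsq
  obtain ⟨⟨hu₀2, hu₀βL, hlogu₀, hβL2⟩, hmain, herr⟩ := H s hxs L u₀ hL_eq rfl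
  have hβL : 0 < β * L := by positivity
  -- `Y = ⌈exp (β L)⌉`
  obtain ⟨hYge, hlogY_lo, hlogY_hi, hY4⟩ := LHalfUpper.ceil_exp_facts hβL2
  set Y : ℕ := ⌈Real.exp (β * L)⌉₊ with hY_def
  have hlogY0 : 0 < Real.log Y := lt_of_lt_of_le hβL hlogY_lo
  -- `u = log x / log Y`
  obtain ⟨hu_le, hu_ge⟩ := LHalfUpper.u_bounds hβL hlogY_lo hlogY_hi hu₀lx hu₀βL hlx_pos
  set u : ℝ := lx / Real.log Y with hu_def
  have hu1 : 1 ≤ u := by linarith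
  have hu0 : 0 < u := by linarith
  have hlogu : Real.log u ≤ Real.log Y / 2 := by
    have : Real.log u ≤ Real.log u₀ := Real.log_le_log hu0 hu_le
    linarith
  -- the explicit bound, with `x^σ = x e^{-u log u}`
  have hexpl := LHalfUpper.card_smoothNumbersUpTo_le_rpow_mul_exp x hY4 hu1 hlogu hK
  rw [LHalfUpper.rpow_sigma_eq (by linarith) hlogY0.ne' rfl, mul_assoc, ← Real.exp_add] at hexpl
  -- the exponent
  have hlogY1 : 1 ≤ Real.log Y := by linarith
  have hlogY2 : Real.log Y ≤ 2 * β * L := by linarith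
  have herr' := LHalfUpper.error_at_u (K := K) (ε := ε) (logY := Real.log Y) hβ hs0 hL0 hL_eq hu0
    hu_le hlogY1 hlogY2 herr
  have hmain' := hmain u hu_ge
  -- monotonicity in `y`
  have hyY : y + 1 ≤ Y + 1 := by
    have : (y : ℝ) ≤ Y := hy.trans hYge
    exact Nat.succ_le_succ (by exact_mod_cast this)
  have hmono : (Nat.smoothNumbersUpTo x (y + 1)).card ≤ (Nat.smoothNumbersUpTo x (Y + 1)).card := by
    refine card_le_card fun n hn => ?_
    rw [Nat.mem_smoothNumbersUpTo] at hn ⊢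
    exact ⟨hn.1, Nat.smoothNumbers_mono hyY hn.2⟩
  calc ((Nat.smoothNumbersUpTo x (y + 1)).card : ℝ) ≤ (Nat.smoothNumbersUpTo x (Y + 1)).card := by
        exact_mod_cast hmono
    _ ≤ (x : ℝ) * Real.exp (-(u * Real.log u) +
          4 * (Real.sqrt u * (Real.log (Real.log Y) + 4) + u * (Real.log 2 + 3 * K / Real.log Y))) :=
        hexpl
    _ ≤ (x : ℝ) * Real.exp (-(1 / (2 * β) - ε) * Real.sqrt (Real.log x * Real.log (Real.log x))) := by
        refine mul_le_mul_of_nonneg_left (Real.exp_le_exp.2 ?_) (Nat.cast_nonneg x)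
        show _ ≤ -(1 / (2 * β) - ε) * L
        linarith

end Literature.NumberTheory.Sieve

end
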